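import Literature.AlgebraicGeometry.HodgeTheory.WeilClasses
import Literature.AlgebraicGeometry.HodgeTheory.GlobalInvariantCycles
import Literature.AlgebraicGeometry.Motives.FamiliesVHS
import HarnessLib.Audit
import HarnessLib

/-!
# WeilTypeLadder · R∞var and R∞anc — the variational decomposition of Weil's question for imaginary quadratic `K` (conjecture leaf)

b2b cell `hweil` (packet `run/shared/lean/b2b/hodge-weil/`; analysis `b2b-hweil-pv2/COR-11-2-4.md`), prover 2
(variational). TWO `@[conjecture]` definitions, obligations of `HodgeConjecture/HodgeConjecture` (both CASES
of the summit; on-path lemmas in the sibling `Theorems/WeilTypeLadderQuadraticVariationalOnPath.lean`), the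
imaginary-quadratic counterparts — on the carriers of the conjecture leaf `Theorems/WeilTypeLadder.lean`
(rung R∞ `WeilClassesImaginaryQuadratic`: `φ ≫ φ = -(d • 𝟙 A)`, Weil plane `weilClassesOf A φ n d`) — of
the CM-field leaves R3var (`WeilVariationalHodgeCMField`, `Theorems/WeilTypeLadderVariational.lean`) and
R3anc (`AnchoredWeilFamiliesCMField`, `Theorems/WeilTypeLadderAnchors.lean`):

* `WeilVariationalHodgeQuadratic` (R∞var) — Weil-confined variational Hodge along smooth projective
  `ℚ(√-d)`-Weil families of abelian `2n`-folds, EVERY `n ≥ 2` and EVERY `d ≥ 1`, over smooth irreducible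
  quasi-projective bases with quasi-projective total space (the Weil-transport shape `WT` of the route
  crux `HeckePrymWeil.WeilVariationalHodge`, stmt-HodgeConjecture-14497 — which is stated for primes
  `p ≡ 3 (4)`, `p ≥ 7`, for ALL `(M,M)` classes and without quasi-projectivity, hence implies R∞var at
  those `d` — extended to all `d` and given the engine-ready hypotheses);
* `AnchoredWeilFamiliesQuadratic` (R∞anc) — every non-zero rational `(n,n)` Weil class of an abelian
  `2n`-fold with `φ² = -d` lies on such a family with an ALGEBRAIC anchor (Markman's product points
  `X × X̂` with `K`-secant sheaves, arXiv:2502.03415 §2.4 / Thm. 1.5.1 for `n ≤ 3` split; Deligne's family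
  LNM 900 Thm. 4.8 (a)–(c) has the anchor `A₀ ⊗ K`).

Kernel-checked in the OnPath sibling: `HC → R∞var`, `HC → R∞anc`, the GLUE R∞anc ∧ R∞var ⟹ R∞
(`WeilClassesImaginaryQuadratic`, hence R2, R2₈, R1′ and stmt-2524/2522 by the arrows of
`Theorems/WeilTypeLadderOnPath.lean`), and R∞anc ∧ LOCAL-R∞var ⟹ R∞ through the base-generic Baire lemma
`mem_algebraicClasses_of_isOpen_subset_algebraicityLocus` (`Theorems/WeilTypeLadderVariationalLocal.lean`).
Nothing here is asserted; no `_holds` is in sight. [status: open]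
-/

-- every declaration of this problem lives in `Summit.HodgeConjecture.HodgeConjecture.…` (summit = sub-problem)
set_option linter.dupNamespace false

noncomputable section

open CategoryTheory

namespace Summit.HodgeConjecture.HodgeConjecture.WeilTypeLadder

open Literature.AlgebraicGeometry Literature.AlgebraicGeometry.Motives
open Literature.AlgebraicGeometry.HodgeTheory
open Literature.AlgebraicTopology.SingularHomology

/-- **R∞var — Weil-confined variational Hodge along `ℚ(√-d)`-Weil families, every `n ≥ 2`, every `d ≥ 1`.**
For a smooth projective family `f : 𝒳 ⟶ S` of relative dimension `2n` with `𝒳`, `S` quasi-projective and `S`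
smooth irreducible, and a global class `W ∈ H^{2n}(𝒳(ℂ); ℂ)` whose fibre restrictions are rational of type
`(n,n)` and carried by charts `e′ : A′.X ≅ 𝒳_s` (`A′` abelian of dimension `2n`, `φ′ ≫ φ′ = -(d • 𝟙 A′)`)
into the Weil plane `weilClassesOf A′ φ′ n d`: if `W|_{𝒳_{s₀}}` is algebraic for ONE complex point then
`W|_{𝒳_s}` is algebraic for EVERY complex point. An instance of Grothendieck's variational Hodge conjecture
(Charles–Schnell Conj. 11.3.1); the `d = p ≡ 3 (4)`, `p ≥ 7` slices are implied by the route crux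
`HeckePrymWeil.WeilVariationalHodge` (stmt-HodgeConjecture-14497). OPEN; known for `n ≤ 3` on split components
through genus-`n` product points (Markman arXiv:2502.03415 Thm. 1.5.1, semiregular secant sheaves). A CASE of
the summit (`weilVariationalHodgeQuadratic_of_hodgeConjecture`).
[cite: CharlesSchnell2014Notes, Conj. 11.3.1 (p. 477)] [cite: Markman2025SecantWeil, Thm. 1.5.1 and §2.4]
[cite: Grothendieck1966, footnote 13] [status: open] -/
@[conjecture] def WeilVariationalHodgeQuadratic : Prop :=
  ∀ (n : ℕ), 2 ≤ n → ∀ (d : ℕ), 0 < d →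
    ∀ ⦃𝒳 S : Motives.SchemeOver ℂ⦄ (f : 𝒳 ⟶ S), Motives.IsSmoothProjectiveFamily f (2 * n) →
      IsQuasiProjectiveOver 𝒳 → IsQuasiProjectiveOver S → IrreducibleSpace S.left →
      AlgebraicGeometry.Smooth S.hom →
      ∀ (W : complexBetti 𝒳 (2 * n)),
        (∀ s : Motives.ComplexPoints S,
          IsRationalClass (complexBetti.map (Motives.fiberι f s) (2 * n) W) ∧
            IsOfHodgeType (2 * n) (Motives.fiberOver f s) (2 * n) n n
              (complexBetti.map (Motives.fiberι f s) (2 * n) W)) →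
        (∀ s : Motives.ComplexPoints S, ∃ (A' : Motives.AbelianVariety ℂ) (φ' : A' ⟶ A')
            (e' : A'.X ≅ Motives.fiberOver f s),
          A'.dim = 2 * n ∧ φ' ≫ φ' = -(d • 𝟙 A') ∧
            complexBetti.map e'.hom (2 * n) (complexBetti.map (Motives.fiberι f s) (2 * n) W) ∈
              weilClassesOf A' φ' n d) →
        (∃ s₀ : Motives.ComplexPoints S,
          complexBetti.map (Motives.fiberι f s₀) (2 * n) W ∈
            algebraicClasses (Motives.fiberOver f s₀) n) →
        ∀ s : Motives.ComplexPoints S,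
          complexBetti.map (Motives.fiberι f s) (2 * n) W ∈ algebraicClasses (Motives.fiberOver f s) n

/-- **R∞anc — every non-zero Weil class (imaginary quadratic `K = ℚ(√-d)`) lies on a smooth projective
`ℚ(√-d)`-Weil family with an ALGEBRAIC anchor.** For `n ≥ 2`, `d ≥ 1`, `A` smooth projective of dimension
`2n` with `φ ≫ φ = -(d • 𝟙 A)`, and a rational `(n,n)`-class `c ≠ 0` of `weilClassesOf A φ n d`: there are a
smooth projective family `f : 𝒳 ⟶ S` of relative dimension `2n` (`𝒳`, `S` quasi-projective, `S` smooth
irreducible), `s₁ s₀ : S(ℂ)`, `ι : A.X ≅ 𝒳_{s₁}`, and `W ∈ H^{2n}(𝒳(ℂ); ℂ)` fibrewise rational of type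
`(n,n)` and carried by charts into the Weil planes, with `ι^*(W|_{𝒳_{s₁}}) = c` and `W|_{𝒳_{s₀}}` algebraic —
the anchor-supply half of the secant-sheaf strategy (product points `X × X̂` with `K`-secant sheaves of
non-zero rank and non-zero Weil component, arXiv:2502.03415 §2.4, §9; every split `(A, η, h)` deforms to
such a point, Lemma 3.1.3 / survey §11.5 Step 1) with the secant machinery abstracted. OPEN in general
(`n ≥ 4`: "the secant variety … is a proper subvariety", §1.2); the route item `HeckePrymWeil.DeligneWeilFamily`
(stmt-16866) is Deligne's family for `d = p ≡ 3 (4)`. A CASE of the summit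
(`anchoredWeilFamiliesQuadratic_of_hodgeConjecture`: under HC the constant family anchored at `A`).
[cite: Markman2025SecantWeil, §1.2, §2.4 and Thm. 1.5.1] [cite: Deligne1982HodgeCycles, Thm. 4.8 (proof, (a)–(c), p. 32)]
[status: open] -/
@[conjecture] def AnchoredWeilFamiliesQuadratic : Prop :=
  ∀ (n : ℕ), 2 ≤ n → ∀ (d : ℕ), 0 < d → ∀ (A : Motives.AbelianVariety ℂ) (φ : A ⟶ A), A.dim = 2 * n →
    Motives.IsSmoothProjective (2 * n) A.X → φ ≫ φ = -(d • 𝟙 A) →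
      ∀ c : complexBetti A.X (2 * n), IsRationalClass c → IsOfHodgeType (2 * n) A.X (2 * n) n n c →
        c ∈ weilClassesOf A φ n d → c ≠ 0 →
        ∃ (𝒳 S : Motives.SchemeOver ℂ) (f : 𝒳 ⟶ S) (s₁ s₀ : Motives.ComplexPoints S)
            (ι : A.X ≅ Motives.fiberOver f s₁) (W : complexBetti 𝒳 (2 * n)),
          Motives.IsSmoothProjectiveFamily f (2 * n) ∧ IsQuasiProjectiveOver 𝒳 ∧ IsQuasiProjectiveOver S ∧
          IrreducibleSpace S.left ∧ AlgebraicGeometry.Smooth S.hom ∧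
          (∀ s : Motives.ComplexPoints S,
            IsRationalClass (complexBetti.map (Motives.fiberι f s) (2 * n) W) ∧
              IsOfHodgeType (2 * n) (Motives.fiberOver f s) (2 * n) n n
                (complexBetti.map (Motives.fiberι f s) (2 * n) W)) ∧
          (∀ s : Motives.ComplexPoints S, ∃ (A' : Motives.AbelianVariety ℂ) (φ' : A' ⟶ A')
              (e' : A'.X ≅ Motives.fiberOver f s),
            A'.dim = 2 * n ∧ φ' ≫ φ' = -(d • 𝟙 A') ∧
              complexBetti.map e'.hom (2 * n) (complexBetti.map (Motives.fiberι f s) (2 * n) W) ∈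
                weilClassesOf A' φ' n d) ∧
          complexBetti.map ι.hom (2 * n) (complexBetti.map (Motives.fiberι f s₁) (2 * n) W) = c ∧
          complexBetti.map (Motives.fiberι f s₀) (2 * n) W ∈ algebraicClasses (Motives.fiberOver f s₀) n

end Summit.HodgeConjecture.HodgeConjecture.WeilTypeLadder

end
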